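import Literature.Combinatorics.Sahi2008.MeasureFunctional
import Literature.Combinatorics.Sahi2008.UniformSquareAllOrders
import HarnessLib

/-!
# Lieb–Sahi (2022), Theorem 3.7 as printed: the `n`-function inequality for Lebesgue measure on the unit square

Topic `Literature/Combinatorics/Sahi2008` (sequel of `UniformSquareAllOrders.lean` — Lieb–Sahi's §3.4 on the
`m × m` grid with its uniform weight, `LiebSahiGrid.sahiPositive_uniformGrid` — and of `MeasureFunctional.lean` —
the measure-level functional `msahiE (μ : Measure Ω) n f`, its moment polynomial `momentE` and the bridge
`msahiE_eq_sahiE_of_moments`).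

## Source (read 2026-08-20 from the materialised arXiv text, corpus `paper:arxiv-2107.09838`, pp. 3, 5, 8)

E. H. Lieb, S. Sahi, *On the extension of the FKG inequality to `n` functions*, J. Math. Phys. **63** (2022)
043301 = arXiv:2107.09838 [LiebSahi2021]:
> (§2) "We will consider the functional `E_3` for functions on the unit hypercube `Q_k = [0,1]^k` … equipped with
> the Lebesgue measure and the usual partial order … We say that a real valued function `f` on `Q_k` is monotone
> (decreasing) if `x ≤ x'` implies `f(x) ≥ f(x')`." (footnote 2: "we use positive as a synonym for non-negative
> and monotone for monotone decreasing. By reversing the partial order, our results and conjectures hold equally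
> for monotone increasing functions.")
> "**THEOREM 2.1.** If `f, g, h` are positive monotone functions on `[0,1]^2` then `E_3(f,g,h) ≥ 0`."
> "**LEMMA 2.3.** It suffices to prove Theorem 2.1 for `χ_a, χ_b, χ_c`; `a, b, c ∈ 𝒜(m)`; for all `m`.
> Proof: … Divide `Q_2` uniformly into `m²` little squares … converge … in `L¹` as `m → ∞`."
> "**THEOREM 3.7.** If `f^1,…,f^n` are positive and monotone on `[0,1]^2` then `E_n(f^1,…,f^n) ≥ 0`."
> "**LEMMA 3.8.** It suffices to prove Theorem 3.7 for `χ_{a^1},…,χ_{a^n}`, `a^i ∈ 𝒜(m)`, for all `m`."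

## What is here (everything PROVED; no named facts; axioms standard)

The tree already has the COMBINATORIAL heart of §3.4 (Thm. 3.13 ⇒ Sahi positivity of every order of the uniform
weight on the `m × m` grid, `LiebSahiGrid.sahiPositive_uniformGrid`).  This file formalises the limit passage
of Lemmas 2.3 / 3.8 and so proves Theorems 2.1 and 3.7 AS PRINTED, for Lebesgue measure (`volume`) on
`unitInterval × unitInterval`:

* `msahiE_volume_nonneg_of_monotone` — `0 ≤ E_n(f_0,…,f_{n−1})` for nonnegative monotone INCREASING
  `f_i : [0,1]² → ℝ`, every `n` (`mSahiPositive_volume_unitSquare : MSahiPositive volume n`);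
* `liebSahi_thm37` — the printed (decreasing) form, every `n`; `liebSahi_thm21` — `n = 3`.

No measurability hypothesis is needed: a monotone function on `[0,1]²` is a.e. equal to a Borel function
(`Monotone.aestronglyMeasurable_unitSquare`, proved here from the same grid sandwich).

## The limit passage (our rendering of Lemma 2.3 / 3.8; the printed proof approximates monotone sets from
inside by unions of grid cells and invokes `L¹` convergence)

For the `(m+1) × (m+1)` grid let `c⁻(p) ≤ p ≤ c⁺(p)` be the lower-left / upper-right corners of the cell of `p`.
For a monotone `g` on `[0,1]²` the step functions `g ∘ c⁻ ≤ g ≤ g ∘ c⁺` have integrals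
`L_m(g) = (m+1)⁻² Σ_{a,b ≤ m} g(a/(m+1), b/(m+1))` and `U_m(g) = (m+1)⁻² Σ g((a+1)/(m+1), (b+1)/(m+1))`, and a
two-way telescoping gives `U_m(g) − L_m(g) ≤ 2(g(1,1) − g(0,0))/(m+1)` (`upperSum_sub_lowerSum_le`).  Applied
to the products `g_S = Π_{i∈S} f_i` this says that the joint moments of the grid family
`(a,b) ↦ f_i(a/(m+1), b/(m+1))` under the uniform grid weight converge to the joint moments of `f` under Lebesgue
measure (`tendsto_gridMoment`).  Since `E_n` is a fixed polynomial in the joint moments (`momentE`,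
`continuous_momentE`), `E_n^{Leb}(f) = lim_m E_n^{grid}(f ∘ grid) ≥ 0` by `LiebSahiGrid.sahiPositive_uniformGrid`.
The decreasing form follows by the reflection `(x,y) ↦ (1−x,1−y)` ([LiebSahi2021, §2]), which preserves
Lebesgue measure (`msahiE_comp_measurePreserving`).
-/

noncomputable section

namespace Literature.Combinatorics.Sahi2008

open Finset Function MeasureTheory Set Filter Topology
open scoped unitInterval

namespace LebesgueSquare

/-! ### The grid of `[0,1]` -/

/-- The grid point `min(a/N, 1) ∈ [0,1]` (`= a/N` for `a ≤ N`). [cite: LiebSahi2021, §2 (eq. (S_a))] -/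
def gridPt (N a : ℕ) : I :=
  ⟨min ((a : ℝ) / N) 1, ⟨le_min (by positivity) zero_le_one, min_le_right _ _⟩⟩

/-- The coordinate of a grid point (plumbing). [folklore] -/
private theorem coe_gridPt (N a : ℕ) : (gridPt N a : ℝ) = min ((a : ℝ) / N) 1 := rfl

/-- The coordinate of a grid point `a/N`, `a ≤ N` (plumbing). [folklore] -/
private theorem coe_gridPt_of_le {N a : ℕ} (hN : 0 < N) (h : a ≤ N) : (gridPt N a : ℝ) = (a : ℝ) / N := by
  rw [coe_gridPt, min_eq_left]
  rw [div_le_one (by exact_mod_cast hN)]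
  exact_mod_cast h

/-- Grid points increase with the index (plumbing). [folklore] -/
private theorem gridPt_mono (N : ℕ) : Monotone (gridPt N) := by
  intro a b hab
  change (gridPt N a : ℝ) ≤ gridPt N b
  simp only [coe_gridPt]
  exact min_le_min_right _ (div_le_div_of_nonneg_right (by exact_mod_cast hab) (Nat.cast_nonneg N))

/-- Grid points are at most `1` (plumbing). [folklore] -/
private theorem gridPt_le_one (N a : ℕ) : gridPt N a ≤ 1 := by
  change (gridPt N a : ℝ) ≤ ((1 : I) : ℝ)
  rw [coe_gridPt, Set.Icc.coe_one]
  exact min_le_right _ _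

/-- `0` is below every grid point (plumbing). [folklore] -/
private theorem zero_le_gridPt (N a : ℕ) : 0 ≤ gridPt N a := by
  change ((0 : I) : ℝ) ≤ (gridPt N a : ℝ)
  rw [Set.Icc.coe_zero]
  exact (gridPt N a).2.1

variable {m : ℕ}

/-- The index `min(⌊(m+1)x⌋, m)` of the cell of the `(m+1) × (m+1)` grid containing `x ∈ [0,1]` (cells
`[a/(m+1), (a+1)/(m+1))`, the last one closed). [cite: LiebSahi2021, §2 (the squares `D_{i,j}`)] -/
def cellIdx (m : ℕ) (x : I) : Fin (m + 1) :=
  ⟨min ⌊((m : ℝ) + 1) * x⌋₊ m, Nat.lt_succ_of_le (min_le_right _ _)⟩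

/-- The lower corner of the cell of `x` is below `x` (plumbing). [folklore] -/
private theorem gridPt_cellIdx_le (x : I) : gridPt (m + 1) (cellIdx m x) ≤ x := by
  change (gridPt (m + 1) (cellIdx m x) : ℝ) ≤ x
  rw [coe_gridPt]
  refine min_le_of_left_le ?_
  have hm : (0 : ℝ) < (m : ℝ) + 1 := by positivity
  have hx : (0 : ℝ) ≤ ((m : ℝ) + 1) * x := mul_nonneg hm.le x.2.1
  have h1 : ((min ⌊((m : ℝ) + 1) * x⌋₊ m : ℕ) : ℝ) ≤ ((m : ℝ) + 1) * x :=
    le_trans (by exact_mod_cast min_le_left _ _) (Nat.floor_le hx)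
  rw [div_le_iff₀ (by push_cast; exact hm)]
  push_cast
  simpa [cellIdx, mul_comm] using h1

/-- `x` is below the upper corner of its cell (plumbing). [folklore] -/
private theorem le_gridPt_cellIdx_succ (x : I) : x ≤ gridPt (m + 1) ((cellIdx m x : ℕ) + 1) := by
  change (x : ℝ) ≤ (gridPt (m + 1) ((cellIdx m x : ℕ) + 1) : ℝ)
  rw [coe_gridPt]
  refine le_min ?_ x.2.2
  have hm : (0 : ℝ) < (m : ℝ) + 1 := by positivity
  rw [le_div_iff₀ (by push_cast; exact hm)]
  by_cases h : ⌊((m : ℝ) + 1) * x⌋₊ ≤ m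
  · have hk : (cellIdx m x : ℕ) = ⌊((m : ℝ) + 1) * x⌋₊ := by
      simp [cellIdx, min_eq_left h]
    rw [hk]
    push_cast
    rw [mul_comm]
    exact (Nat.lt_floor_add_one _).le
  · have hk : (cellIdx m x : ℕ) = m := by
      simp [cellIdx, min_eq_right (not_le.1 h).le]
    rw [hk]
    push_cast
    have hx1 : (x : ℝ) ≤ 1 := x.2.2
    nlinarith

/-- The cell index is a measurable function (plumbing). [folklore] -/
private theorem measurable_cellIdx (m : ℕ) : Measurable (cellIdx m) := by
  have h1 : Measurable fun x : I => ⌊((m : ℝ) + 1) * (x : ℝ)⌋₊ :=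
    Nat.measurable_floor.comp (measurable_const.mul measurable_subtype_coe)
  have h2 : Measurable fun k : ℕ => (⟨min k m, Nat.lt_succ_of_le (min_le_right _ _)⟩ : Fin (m + 1)) :=
    measurable_from_top
  exact h2.comp h1

/-- A cell other than the last is the half-open interval `[k/(m+1), (k+1)/(m+1))` (plumbing). [folklore] -/
private theorem cellIdx_preimage_of_lt {k : ℕ} (hk : k < m) :
    cellIdx m ⁻¹' {(⟨k, Nat.lt_succ_of_lt hk⟩ : Fin (m + 1))} =
      Set.Ico (gridPt (m + 1) k) (gridPt (m + 1) (k + 1)) := by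
  have hm : (0 : ℝ) < (m : ℝ) + 1 := by positivity
  ext x
  simp only [Set.mem_preimage, Set.mem_singleton_iff, Set.mem_Ico, Fin.ext_iff, cellIdx]
  rw [← Subtype.coe_le_coe, ← Subtype.coe_lt_coe, coe_gridPt_of_le (Nat.succ_pos m) (by omega),
    coe_gridPt_of_le (Nat.succ_pos m) (by omega)]
  have hx : (0 : ℝ) ≤ ((m : ℝ) + 1) * x := mul_nonneg hm.le x.2.1
  push_cast
  rw [div_le_iff₀ hm, lt_div_iff₀ hm]
  constructor
  · intro h
    have hfl : ⌊((m : ℝ) + 1) * x⌋₊ = k := by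
      rcases le_total ⌊((m : ℝ) + 1) * x⌋₊ m with h' | h'
      · rwa [min_eq_left h'] at h
      · rw [min_eq_right h'] at h
        omega
    rw [Nat.floor_eq_iff hx] at hfl
    constructor <;> linarith [hfl.1, hfl.2]
  · rintro ⟨h1, h2⟩
    have hfl : ⌊((m : ℝ) + 1) * x⌋₊ = k := by
      rw [Nat.floor_eq_iff hx]
      constructor <;> linarith
    rw [hfl]
    exact min_eq_left hk.le

/-- The last cell is the closed interval `[m/(m+1), 1]` (plumbing). [folklore] -/
private theorem cellIdx_preimage_last :
    cellIdx m ⁻¹' {(⟨m, Nat.lt_succ_self m⟩ : Fin (m + 1))} = Set.Ici (gridPt (m + 1) m) := by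
  have hm : (0 : ℝ) < (m : ℝ) + 1 := by positivity
  ext x
  simp only [Set.mem_preimage, Set.mem_singleton_iff, Set.mem_Ici, Fin.ext_iff, cellIdx]
  rw [← Subtype.coe_le_coe, coe_gridPt_of_le (Nat.succ_pos m) (Nat.le_succ m)]
  have hx : (0 : ℝ) ≤ ((m : ℝ) + 1) * x := mul_nonneg hm.le x.2.1
  push_cast
  rw [div_le_iff₀ hm, min_eq_right_iff, Nat.le_floor_iff hx, mul_comm]

/-- Every cell of `[0,1]` has length `1/(m+1)` (plumbing). [folklore] -/
private theorem volume_cellIdx_preimage (k : Fin (m + 1)) :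
    volume (cellIdx m ⁻¹' {k}) = ENNReal.ofReal (1 / ((m : ℝ) + 1)) := by
  have hm : (0 : ℝ) < (m : ℝ) + 1 := by positivity
  rcases lt_or_eq_of_le (Nat.le_of_lt_succ k.2) with hk | hk
  · have hkk : k = ⟨(k : ℕ), Nat.lt_succ_of_lt hk⟩ := Fin.ext rfl
    rw [hkk, cellIdx_preimage_of_lt hk, unitInterval.volume_Ico,
      coe_gridPt_of_le (Nat.succ_pos m) (by omega), coe_gridPt_of_le (Nat.succ_pos m) (Nat.le_succ_of_le hk.le)]
    congr 1
    push_cast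
    field_simp
    ring
  · have hkk : k = ⟨m, Nat.lt_succ_self m⟩ := Fin.ext hk
    rw [hkk, cellIdx_preimage_last, unitInterval.volume_Ici, coe_gridPt_of_le (Nat.succ_pos m) (Nat.le_succ m)]
    congr 1
    push_cast
    field_simp
    ring

/-! ### The grid of the square -/

/-- The cell of the `(m+1) × (m+1)` grid of `[0,1]²` containing `p`. [cite: LiebSahi2021, §2 (the squares `D_{i,j}`)] -/
def cellPair (m : ℕ) (p : I × I) : Fin (m + 1) × Fin (m + 1) := (cellIdx m p.1, cellIdx m p.2)

/-- The cell map is measurable (plumbing). [folklore] -/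
private theorem measurable_cellPair (m : ℕ) : Measurable (cellPair m) :=
  ((measurable_cellIdx m).comp measurable_fst).prodMk ((measurable_cellIdx m).comp measurable_snd)

/-- Every cell of the square has area `1/(m+1)²`, the uniform grid weight (plumbing). [folklore] -/
private theorem volume_real_cellPair_preimage (c : Fin (m + 1) × Fin (m + 1)) :
    volume.real (cellPair m ⁻¹' {c}) = LiebSahiGrid.gridWeight (m + 1) c := by
  have hm : (0 : ℝ) ≤ 1 / ((m : ℝ) + 1) := by positivity
  have hset : cellPair m ⁻¹' {c} = (cellIdx m ⁻¹' {c.1}) ×ˢ (cellIdx m ⁻¹' {c.2}) := by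
    ext p
    simp only [Set.mem_preimage, Set.mem_singleton_iff, Set.mem_prod, cellPair, Prod.ext_iff]
  rw [measureReal_def, hset, Measure.volume_eq_prod, Measure.prod_prod, volume_cellIdx_preimage,
    volume_cellIdx_preimage, ← ENNReal.ofReal_mul hm, ENNReal.toReal_ofReal (mul_nonneg hm hm),
    LiebSahiGrid.gridWeight]
  push_cast
  field_simp

/-- The lower-left corner of the cell of `p`. [cite: LiebSahi2021, §2 (the squares `D_{i,j}`)] -/
def loCorner (m : ℕ) (c : Fin (m + 1) × Fin (m + 1)) : I × I := (gridPt (m + 1) c.1, gridPt (m + 1) c.2)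

/-- The upper-right corner of the cell of `p` (Lieb–Sahi index `D_{i,j}` by its top right vertex `(i/m, j/m)`).
[cite: LiebSahi2021, §2 (the squares `D_{i,j}`)] -/
def hiCorner (m : ℕ) (c : Fin (m + 1) × Fin (m + 1)) : I × I :=
  (gridPt (m + 1) ((c.1 : ℕ) + 1), gridPt (m + 1) ((c.2 : ℕ) + 1))

/-- `c⁻(p) ≤ p` (plumbing). [folklore] -/
private theorem loCorner_cellPair_le (p : I × I) : loCorner m (cellPair m p) ≤ p :=
  ⟨gridPt_cellIdx_le p.1, gridPt_cellIdx_le p.2⟩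

/-- `p ≤ c⁺(p)` (plumbing). [folklore] -/
private theorem le_hiCorner_cellPair (p : I × I) : p ≤ hiCorner m (cellPair m p) :=
  ⟨le_gridPt_cellIdx_succ p.1, le_gridPt_cellIdx_succ p.2⟩

/-- `loCorner` is monotone in the cell (plumbing). [folklore] -/
private theorem loCorner_mono (m : ℕ) : Monotone (loCorner m) := fun _ _ h =>
  ⟨gridPt_mono _ (by exact_mod_cast h.1), gridPt_mono _ (by exact_mod_cast h.2)⟩

/-- The top point `(1,1)` dominates (plumbing). [folklore] -/
private theorem le_one_one (p : I × I) : p ≤ (1, 1) :=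
  ⟨show (p.1 : ℝ) ≤ ((1 : I) : ℝ) by rw [Set.Icc.coe_one]; exact p.1.2.2,
    show (p.2 : ℝ) ≤ ((1 : I) : ℝ) by rw [Set.Icc.coe_one]; exact p.2.2.2⟩

/-- The bottom point `(0,0)` is dominated (plumbing). [folklore] -/
private theorem zero_zero_le (p : I × I) : ((0 : I), (0 : I)) ≤ p :=
  ⟨show ((0 : I) : ℝ) ≤ (p.1 : ℝ) by rw [Set.Icc.coe_zero]; exact p.1.2.1,
    show ((0 : I) : ℝ) ≤ (p.2 : ℝ) by rw [Set.Icc.coe_zero]; exact p.2.2.1⟩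

/-- **Integral of a grid step function** = its expectation under the uniform grid weight:
`∫ γ(cell(p)) dp = (m+1)⁻² Σ_c γ(c)`. [cite: LiebSahi2021, Lemma 2.3 (proof)] -/
theorem integral_comp_cellPair (γ : Fin (m + 1) × Fin (m + 1) → ℝ) :
    ∫ p, γ (cellPair m p) ∂volume = ex (LiebSahiGrid.gridWeight (m + 1)) γ := by
  have hγ : AEStronglyMeasurable γ (volume.map (cellPair m)) :=
    (measurable_of_countable γ).aestronglyMeasurable
  rw [← integral_map (measurable_cellPair m).aemeasurable hγ,
    integral_fintype (Integrable.of_finite (μ := volume.map (cellPair m)) (f := γ)), ex]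
  refine sum_congr rfl fun c _ => ?_
  rw [map_measureReal_apply (measurable_cellPair m) (measurableSet_singleton c),
    volume_real_cellPair_preimage, smul_eq_mul]

/-- A grid step function is integrable (plumbing). [folklore] -/
private theorem integrable_comp_cellPair (γ : Fin (m + 1) × Fin (m + 1) → ℝ) :
    Integrable (fun p => γ (cellPair m p)) volume :=
  (Integrable.of_finite (μ := volume.map (cellPair m)) (f := γ)).comp_measurable (measurable_cellPair m)

/-! ### Lower and upper Riemann sums of a monotone function -/

/-- The lower grid sum `L_m(g) = (m+1)⁻² Σ_c g(c⁻)`. [cite: LiebSahi2021, Lemma 2.3 (proof)] -/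
def lowerSum (m : ℕ) (g : I × I → ℝ) : ℝ := ex (LiebSahiGrid.gridWeight (m + 1)) (g ∘ loCorner m)

/-- The upper grid sum `U_m(g) = (m+1)⁻² Σ_c g(c⁺)`. [cite: LiebSahi2021, Lemma 2.3 (proof)] -/
def upperSum (m : ℕ) (g : I × I → ℝ) : ℝ := ex (LiebSahiGrid.gridWeight (m + 1)) (g ∘ hiCorner m)

/-- **Lower sandwich**: `L_m(g) ≤ ∫ g` for a monotone integrable `g`. [cite: LiebSahi2021, Lemma 2.3 (proof)] -/
theorem lowerSum_le_integral {g : I × I → ℝ} (hg : Monotone g) (hgi : Integrable g volume) :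
    lowerSum m g ≤ ∫ p, g p ∂volume := by
  rw [lowerSum, ← integral_comp_cellPair]
  exact integral_mono (integrable_comp_cellPair _) hgi fun p => hg (loCorner_cellPair_le p)

/-- **Upper sandwich**: `∫ g ≤ U_m(g)` for a monotone integrable `g`. [cite: LiebSahi2021, Lemma 2.3 (proof)] -/
theorem integral_le_upperSum {g : I × I → ℝ} (hg : Monotone g) (hgi : Integrable g volume) :
    ∫ p, g p ∂volume ≤ upperSum m g := by
  rw [upperSum, ← integral_comp_cellPair]
  exact integral_mono hgi (integrable_comp_cellPair _) fun p => hg (le_hiCorner_cellPair p)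

/-- Two-way telescoping on the grid (plumbing): for `h` monotone in each argument,
`Σ_{a,b ≤ m} (h(a+1,b+1) − h(a,b)) ≤ 2(m+1)(h(m+1,m+1) − h(0,0))`. [folklore] -/
private theorem sum_sub_le_of_monotone (h : ℕ → ℕ → ℝ) (h1 : ∀ b, Monotone fun a => h a b)
    (h2 : ∀ a, Monotone fun b => h a b) (m : ℕ) :
    ∑ a ∈ range (m + 1), ∑ b ∈ range (m + 1), (h (a + 1) (b + 1) - h a b) ≤
      2 * ((m : ℝ) + 1) * (h (m + 1) (m + 1) - h 0 0) := by
  have hsplit : ∀ a b, h (a + 1) (b + 1) - h a b = (h (a + 1) (b + 1) - h a (b + 1)) + (h a (b + 1) - h a b) :=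
    fun a b => by ring
  simp only [hsplit, sum_add_distrib]
  rw [sum_comm]
  have hA : ∑ b ∈ range (m + 1), ∑ a ∈ range (m + 1), (h (a + 1) (b + 1) - h a (b + 1)) ≤
      ((m : ℝ) + 1) * (h (m + 1) (m + 1) - h 0 0) := by
    calc ∑ b ∈ range (m + 1), ∑ a ∈ range (m + 1), (h (a + 1) (b + 1) - h a (b + 1))
        = ∑ b ∈ range (m + 1), (h (m + 1) (b + 1) - h 0 (b + 1)) :=
          sum_congr rfl fun b _ => Finset.sum_range_sub (fun a => h a (b + 1)) (m + 1)
      _ ≤ ∑ b ∈ range (m + 1), (h (m + 1) (m + 1) - h 0 0) := by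
          refine sum_le_sum fun b hb => sub_le_sub ?_ ?_
          · exact h2 (m + 1) (by have := mem_range.1 hb; omega)
          · exact h2 0 (Nat.zero_le _)
      _ = ((m : ℝ) + 1) * (h (m + 1) (m + 1) - h 0 0) := by
          rw [sum_const, card_range, nsmul_eq_mul]
          push_cast
          ring
  have hB : ∑ a ∈ range (m + 1), ∑ b ∈ range (m + 1), (h a (b + 1) - h a b) ≤
      ((m : ℝ) + 1) * (h (m + 1) (m + 1) - h 0 0) := by
    calc ∑ a ∈ range (m + 1), ∑ b ∈ range (m + 1), (h a (b + 1) - h a b)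
        = ∑ a ∈ range (m + 1), (h a (m + 1) - h a 0) :=
          sum_congr rfl fun a _ => Finset.sum_range_sub (fun b => h a b) (m + 1)
      _ ≤ ∑ a ∈ range (m + 1), (h (m + 1) (m + 1) - h 0 0) := by
          refine sum_le_sum fun a ha => sub_le_sub ?_ ?_
          · exact h1 (m + 1) (by have := mem_range.1 ha; omega)
          · exact h1 0 (Nat.zero_le _)
      _ = ((m : ℝ) + 1) * (h (m + 1) (m + 1) - h 0 0) := by
          rw [sum_const, card_range, nsmul_eq_mul]
          push_cast
          ring
  linarith

/-- **The sandwich closes**: `U_m(g) − L_m(g) ≤ 2(g(1,1) − g(0,0))/(m+1)` for a monotone `g` on `[0,1]²` (the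
boundary cells of a staircase number `O(m)` out of `(m+1)²`). [cite: LiebSahi2021, Lemma 2.3 (proof)] -/
theorem upperSum_sub_lowerSum_le {g : I × I → ℝ} (hg : Monotone g) (m : ℕ) :
    upperSum m g - lowerSum m g ≤ 2 * (g (1, 1) - g (0, 0)) / ((m : ℝ) + 1) := by
  have hm : (0 : ℝ) < (m : ℝ) + 1 := by positivity
  set h : ℕ → ℕ → ℝ := fun a b => g (gridPt (m + 1) a, gridPt (m + 1) b) with hh
  have h1 : ∀ b, Monotone fun a => h a b := fun b a a' haa' =>
    hg ⟨gridPt_mono _ haa', le_rfl⟩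
  have h2 : ∀ a, Monotone fun b => h a b := fun a b b' hbb' =>
    hg ⟨le_rfl, gridPt_mono _ hbb'⟩
  have hdiff : upperSum m g - lowerSum m g =
      (∑ a ∈ range (m + 1), ∑ b ∈ range (m + 1), (h (a + 1) (b + 1) - h a b)) / ((m : ℝ) + 1) ^ 2 := by
    rw [upperSum, lowerSum, ex, ex, ← sum_sub_distrib, Fintype.sum_prod_type]
    simp only [Finset.sum_range, sum_div]
    refine sum_congr rfl fun a _ => sum_congr rfl fun b _ => ?_
    simp only [LiebSahiGrid.gridWeight, Function.comp_apply, hiCorner, loCorner, hh]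
    push_cast
    ring
  have hmm : h (m + 1) (m + 1) - h 0 0 ≤ g (1, 1) - g (0, 0) := by
    refine sub_le_sub (hg (le_one_one _)) (hg ?_)
    exact ⟨zero_le_gridPt _ _, zero_le_gridPt _ _⟩
  rw [hdiff, div_le_div_iff₀ (by positivity) hm]
  calc (∑ a ∈ range (m + 1), ∑ b ∈ range (m + 1), (h (a + 1) (b + 1) - h a b)) * ((m : ℝ) + 1)
      ≤ 2 * ((m : ℝ) + 1) * (h (m + 1) (m + 1) - h 0 0) * ((m : ℝ) + 1) :=
        mul_le_mul_of_nonneg_right (sum_sub_le_of_monotone h h1 h2 m) hm.le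
    _ ≤ 2 * ((m : ℝ) + 1) * (g (1, 1) - g (0, 0)) * ((m : ℝ) + 1) := by
        have : (0 : ℝ) ≤ 2 * ((m : ℝ) + 1) := by positivity
        nlinarith [hmm]
    _ = 2 * (g (1, 1) - g (0, 0)) * ((m : ℝ) + 1) ^ 2 := by ring

/-! ### Monotone functions on the square are a.e. Borel -/

/-- **A monotone function on `[0,1]²` is a.e. strongly measurable for Lebesgue measure** (it is squeezed
between the Borel functions `sup_m g ∘ c⁻_m ≤ g ≤ inf_m g ∘ c⁺_m`, whose difference has integral
`≤ 2(g(1,1) − g(0,0))/(m+1)` for every `m`, hence vanishes a.e.).  This is why Theorem 3.7 needs no measurability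
hypothesis. [cite: LiebSahi2021, Lemma 2.3 (proof)] -/
theorem _root_.Monotone.aestronglyMeasurable_unitSquare {g : I × I → ℝ} (hg : Monotone g) :
    AEStronglyMeasurable g (volume : Measure (I × I)) := by
  -- the lower / upper step functions
  set s : ℕ → I × I → ℝ := fun m p => g (loCorner m (cellPair m p)) with hs
  set t : ℕ → I × I → ℝ := fun m p => g (hiCorner m (cellPair m p)) with ht
  have hs_le : ∀ m p, s m p ≤ g p := fun m p => hg (loCorner_cellPair_le p)
  have hle_t : ∀ m p, g p ≤ t m p := fun m p => hg (le_hiCorner_cellPair p)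
  have hs_meas : ∀ m, Measurable (s m) := fun m =>
    (measurable_of_countable (g ∘ loCorner m)).comp (measurable_cellPair m)
  have ht_meas : ∀ m, Measurable (t m) := fun m =>
    (measurable_of_countable (g ∘ hiCorner m)).comp (measurable_cellPair m)
  -- their sup / inf
  set l : I × I → ℝ := fun p => ⨆ m, s m p with hl
  set u : I × I → ℝ := fun p => ⨅ m, t m p with hu
  have hl_meas : Measurable l := Measurable.iSup hs_meas
  have hu_meas : Measurable u := Measurable.iInf ht_meas
  have hbdd_s : ∀ p, BddAbove (Set.range fun m => s m p) := fun p => ⟨g p, by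
    rintro _ ⟨m, rfl⟩; exact hs_le m p⟩
  have hbdd_t : ∀ p, BddBelow (Set.range fun m => t m p) := fun p => ⟨g p, by
    rintro _ ⟨m, rfl⟩; exact hle_t m p⟩
  have hl_le : ∀ p, l p ≤ g p := fun p => ciSup_le fun m => hs_le m p
  have hle_u : ∀ p, g p ≤ u p := fun p => le_ciInf fun m => hle_t m p
  have hs_le_l : ∀ m p, s m p ≤ l p := fun m p => le_ciSup (hbdd_s p) m
  have hu_le_t : ∀ m p, u p ≤ t m p := fun m p => ciInf_le (hbdd_t p) m
  -- the gap `u − l` is nonnegative, bounded, Borel, with integral ≤ 2B/(m+1) for every m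
  set B : ℝ := g (1, 1) - g (0, 0) with hB
  have hgap_nonneg : ∀ p, 0 ≤ u p - l p := fun p => sub_nonneg.2 ((hl_le p).trans (hle_u p))
  have hgap_le : ∀ m p, u p - l p ≤ t m p - s m p := fun m p => sub_le_sub (hu_le_t m p) (hs_le_l m p)
  have hts_le : ∀ m p, t m p - s m p ≤ B := fun m p =>
    sub_le_sub (hg (le_one_one _)) (hg (zero_zero_le _))
  have hgap_int : Integrable (fun p => u p - l p) volume := by
    refine Integrable.mono' (integrable_const B) (hu_meas.sub hl_meas).aestronglyMeasurable
      (Eventually.of_forall fun p => ?_)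
    rw [Real.norm_eq_abs, abs_of_nonneg (hgap_nonneg p)]
    exact (hgap_le 0 p).trans (hts_le 0 p)
  have hint_le : ∀ m : ℕ, ∫ p, (u p - l p) ∂volume ≤ 2 * B / ((m : ℝ) + 1) := by
    intro m
    have h1 : Integrable (fun p => t m p) volume := integrable_comp_cellPair (g ∘ hiCorner m)
    have h2 : Integrable (fun p => s m p) volume := integrable_comp_cellPair (g ∘ loCorner m)
    have e1 : ∫ p, t m p ∂volume = upperSum m g := integral_comp_cellPair (g ∘ hiCorner m)
    have e2 : ∫ p, s m p ∂volume = lowerSum m g := integral_comp_cellPair (g ∘ loCorner m)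
    have e : ∫ p, (t m p - s m p) ∂volume = (∫ p, t m p ∂volume) - ∫ p, s m p ∂volume := integral_sub h1 h2
    calc ∫ p, (u p - l p) ∂volume ≤ ∫ p, (t m p - s m p) ∂volume :=
          integral_mono hgap_int (h1.sub h2) fun p => hgap_le m p
      _ = upperSum m g - lowerSum m g := by rw [e, e1, e2]
      _ ≤ 2 * B / ((m : ℝ) + 1) := upperSum_sub_lowerSum_le hg m
  have hint_zero : ∫ p, (u p - l p) ∂volume = 0 := by
    refine le_antisymm ?_ (integral_nonneg fun p => hgap_nonneg p)
    have hlim : Tendsto (fun m : ℕ => 2 * B / ((m : ℝ) + 1)) atTop (𝓝 0) := by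
      have h := (tendsto_const_div_atTop_nhds_zero_nat (2 * B)).comp (tendsto_add_atTop_nat 1)
      refine h.congr fun m => ?_
      simp only [Function.comp_apply, Nat.cast_add, Nat.cast_one]
    exact ge_of_tendsto' hlim hint_le
  have hae : (fun p => u p - l p) =ᵐ[volume] 0 :=
    (integral_eq_zero_iff_of_nonneg (fun p => hgap_nonneg p) hgap_int).1 hint_zero
  have hgl : g =ᵐ[volume] l := by
    filter_upwards [hae] with p hp
    have hp' : u p = l p := by
      have := hp; simp only [Pi.zero_apply] at this; linarith
    exact le_antisymm ((hle_u p).trans hp'.le) (hl_le p)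
  exact (hl_meas.aestronglyMeasurable).congr hgl.symm

/-- A nonnegative... rather: a monotone function on `[0,1]²` is integrable for Lebesgue measure (bounded by its
values at `(0,0)` and `(1,1)`, a.e. Borel). [cite: LiebSahi2021, §2 (setting: positive monotone functions on `Q_2`)] -/
theorem _root_.Monotone.integrable_unitSquare {g : I × I → ℝ} (hg : Monotone g) :
    Integrable g (volume : Measure (I × I)) := by
  refine Integrable.mono' (integrable_const (|g (0, 0)| + |g (1, 1)|)) hg.aestronglyMeasurable_unitSquare
    (Eventually.of_forall fun p => ?_)
  rw [Real.norm_eq_abs]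
  have h1 := hg (zero_zero_le p)
  have h2 := hg (le_one_one p)
  rcases le_total 0 (g p) with h | h
  · rw [abs_of_nonneg h]
    linarith [le_abs_self (g (1, 1)), abs_nonneg (g (0, 0))]
  · rw [abs_of_nonpos h]
    linarith [neg_abs_le (g (0, 0)), abs_nonneg (g (1, 1))]

/-! ### Joint moments: grid versus Lebesgue -/

variable {n : ℕ}

/-- The grid family of level `m`: `(a, b) ↦ f_i(a/(m+1), b/(m+1))` on `Fin (m+1) × Fin (m+1)` (the values of
`f_i` at the lower-left corners of the cells). [cite: LiebSahi2021, Lemma 2.3 / Lemma 3.8] -/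
def gridFam (m : ℕ) (f : Fin n → I × I → ℝ) (i : Fin n) : Fin (m + 1) × Fin (m + 1) → ℝ :=
  f i ∘ loCorner m

/-- The grid family is nonnegative if `f` is. [cite: LiebSahi2021, Lemma 3.8] -/
theorem gridFam_nonneg {f : Fin n → I × I → ℝ} (hf0 : ∀ i x, 0 ≤ f i x) (m : ℕ) :
    ∀ i c, 0 ≤ gridFam m f i c := fun i _ => hf0 i _

/-- The grid family is monotone if `f` is. [cite: LiebSahi2021, Lemma 3.8] -/
theorem gridFam_monotone {f : Fin n → I × I → ℝ} (hmono : ∀ i, Monotone (f i)) (m : ℕ) :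
    ∀ i, Monotone (gridFam m f i) := fun i => (hmono i).comp (loCorner_mono m)

/-- A finite product of nonnegative monotone real functions is monotone (plumbing). [folklore] -/
private theorem monotone_finset_prod {β : Type*} [Preorder β] {f : Fin n → β → ℝ} (hf0 : ∀ i x, 0 ≤ f i x)
    (hmono : ∀ i, Monotone (f i)) (S : Finset (Fin n)) : Monotone (∏ i ∈ S, f i) := by
  classical
  induction S using Finset.induction_on with
  | empty =>
    rw [Finset.prod_empty]
    exact monotone_const
  | insert a S ha ih =>
    rw [Finset.prod_insert ha]
    exact (hmono a).mul ih (hf0 a) fun x => by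
      rw [Finset.prod_apply]; exact prod_nonneg fun i _ => hf0 i x

/-- **The joint moments of the grid family converge to those of `f`**:
`E_grid(Π_{i∈S} f_i ∘ c⁻) → ∫ Π_{i∈S} f_i` as the mesh `1/(m+1) → 0` — the `L¹` limit of Lemmas 2.3 / 3.8 in
moment form. [cite: LiebSahi2021, Lemma 2.3 and Lemma 3.8] -/
theorem tendsto_gridMoment {f : Fin n → I × I → ℝ} (hf0 : ∀ i x, 0 ≤ f i x) (hmono : ∀ i, Monotone (f i))
    (S : Finset (Fin n)) :
    Tendsto (fun m => ex (LiebSahiGrid.gridWeight (m + 1)) (∏ i ∈ S, gridFam m f i)) atTop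
      (𝓝 (∫ p, (∏ i ∈ S, f i) p ∂volume)) := by
  set g : I × I → ℝ := ∏ i ∈ S, f i with hgdef
  have hg : Monotone g := monotone_finset_prod hf0 hmono S
  have hgi : Integrable g volume := hg.integrable_unitSquare
  have hlo : ∀ m, ex (LiebSahiGrid.gridWeight (m + 1)) (∏ i ∈ S, gridFam m f i) = lowerSum m g := by
    intro m
    rw [lowerSum]
    congr 1
    funext c
    simp only [Finset.prod_apply, Function.comp_apply, gridFam, hgdef]
  simp only [hlo]
  set B : ℝ := g (1, 1) - g (0, 0) with hB
  have hlim0 : Tendsto (fun m : ℕ => (∫ p, g p ∂volume) - 2 * B / ((m : ℝ) + 1)) atTop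
      (𝓝 (∫ p, g p ∂volume)) := by
    have h := (tendsto_const_div_atTop_nhds_zero_nat (2 * B)).comp (tendsto_add_atTop_nat 1)
    have h' : Tendsto (fun m : ℕ => 2 * B / ((m : ℝ) + 1)) atTop (𝓝 0) := by
      refine h.congr fun m => ?_
      simp only [Function.comp_apply, Nat.cast_add, Nat.cast_one]
    simpa using (tendsto_const_nhds (x := ∫ p, g p ∂volume)).sub h'
  refine tendsto_of_tendsto_of_tendsto_of_le_of_le hlim0 tendsto_const_nhds (fun m => ?_) fun m => ?_
  · have h1 := integral_le_upperSum (m := m) hg hgi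
    have h2 := upperSum_sub_lowerSum_le hg m
    linarith
  · exact lowerSum_le_integral hg hgi

end LebesgueSquare

open LebesgueSquare

/-! ### Theorem 3.7 -/

/-- **Lieb–Sahi's Theorem 3.7 (increasing form): for Lebesgue measure on the unit square and every `n`,
`E_n(f_0,…,f_{n−1}) ≥ 0` for all nonnegative monotone increasing `f_i : [0,1]² → ℝ`.**  Proof: `E_n` is the
moment polynomial at the joint moments (`msahiE_eq_momentE`), the joint moments are limits of the grid moments
(`tendsto_gridMoment`), the polynomial is continuous (`continuous_momentE`), and on each grid `E_n ≥ 0` by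
Lieb–Sahi's Theorem 3.13 (`LiebSahiGrid.sahiPositive_uniformGrid`).  No measurability hypothesis (monotone
functions are a.e. Borel). [cite: LiebSahi2021, Thm. 3.7 (with Lemma 3.8 and footnote 2)] -/
theorem msahiE_volume_nonneg_of_monotone (n : ℕ) (f : Fin n → I × I → ℝ) (hf0 : ∀ i x, 0 ≤ f i x)
    (hmono : ∀ i, Monotone (f i)) : 0 ≤ msahiE (volume : Measure (I × I)) n f := by
  set M : Finset (Fin n) → ℝ := fun S => ∫ p, (∏ i ∈ S, f i) p ∂volume with hM
  have hE : msahiE (volume : Measure (I × I)) n f = momentE n M := msahiE_eq_momentE _ n f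
  have hlim : Tendsto (fun m => momentE n fun S => ex (LiebSahiGrid.gridWeight (m + 1)) (∏ i ∈ S, gridFam m f i))
      atTop (𝓝 (momentE n M)) :=
    ((continuous_momentE n).tendsto M).comp (tendsto_pi_nhds.2 fun S => tendsto_gridMoment hf0 hmono S)
  have hpos : ∀ m, 0 ≤ momentE n fun S => ex (LiebSahiGrid.gridWeight (m + 1)) (∏ i ∈ S, gridFam m f i) := by
    intro m
    rw [← sahiE_eq_momentE]
    exact LiebSahiGrid.sahiPositive_uniformGrid (Nat.succ_pos m) n _ (gridFam_nonneg hf0 m)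
      (gridFam_monotone hmono m)
  rw [hE]
  exact ge_of_tendsto' hlim hpos

/-- **Lebesgue measure on the unit square is Sahi-positive of every order** (Theorem 3.7, increasing form, as a
property of the measure). [cite: LiebSahi2021, Thm. 3.7] -/
theorem mSahiPositive_volume_unitSquare (n : ℕ) : MSahiPositive (volume : Measure (I × I)) n :=
  fun f hf0 hmono => msahiE_volume_nonneg_of_monotone n f hf0 hmono

/-- The central reflection `(x, y) ↦ (1 − x, 1 − y)` of the square (Lieb–Sahi's change of variables
`x_i ↦ 1 − x_i`). [cite: LiebSahi2021, §2 (before Thm. 2.1)] -/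
def LebesgueSquare.reflect : I × I → I × I := Prod.map unitInterval.symm unitInterval.symm

/-- The reflection preserves Lebesgue measure (plumbing). [folklore] -/
private theorem measurePreserving_reflect :
    MeasurePreserving LebesgueSquare.reflect (volume : Measure (I × I)) volume := by
  rw [Measure.volume_eq_prod]
  exact unitInterval.measurePreserving_symm.prod unitInterval.measurePreserving_symm

/-- The reflection is a measurable embedding (plumbing). [folklore] -/
private theorem measurableEmbedding_reflect : MeasurableEmbedding LebesgueSquare.reflect :=
  (unitInterval.symmMeasurableEquiv.prodCongr unitInterval.symmMeasurableEquiv).measurableEmbedding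

/-- **Lieb–Sahi's Theorem 3.7, as printed** ("positive" = nonnegative, "monotone" = monotone DECREASING):
if `f^1,…,f^n` are positive and monotone on `[0,1]²` then `E_n(f^1,…,f^n) ≥ 0`, `E_n` taken for Lebesgue
measure on the unit square.  From the increasing form by the reflection `(x,y) ↦ (1−x,1−y)`, which preserves
Lebesgue measure and reverses the order. [cite: LiebSahi2021, Thm. 3.7] -/
theorem liebSahi_thm37 (n : ℕ) (f : Fin n → I × I → ℝ) (hf0 : ∀ i x, 0 ≤ f i x)
    (hanti : ∀ i, Antitone (f i)) : 0 ≤ msahiE (volume : Measure (I × I)) n f := by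
  rw [← msahiE_comp_measurePreserving measurePreserving_reflect measurableEmbedding_reflect n f]
  refine msahiE_volume_nonneg_of_monotone n _ (fun i x => hf0 i _) fun i p q hpq => hanti i ?_
  exact ⟨unitInterval.symm_le_symm.2 hpq.1, unitInterval.symm_le_symm.2 hpq.2⟩

/-- **Lieb–Sahi's Theorem 2.1, as printed**: if `f, g, h` are positive monotone (decreasing) functions on
`[0,1]²` then `E_3(f,g,h) = 2𝔼(fgh) + 𝔼(f)𝔼(g)𝔼(h) − 𝔼(f)𝔼(gh) − 𝔼(g)𝔼(fh) − 𝔼(h)𝔼(fg) ≥ 0`, `𝔼 = ∫ · dλ`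
over the unit square. [cite: LiebSahi2021, Thm. 2.1 and eq. (2.1)] -/
theorem liebSahi_thm21 (f g h : I × I → ℝ) (hf : ∀ x, 0 ≤ f x) (hg : ∀ x, 0 ≤ g x) (hh : ∀ x, 0 ≤ h x)
    (hfa : Antitone f) (hga : Antitone g) (hha : Antitone h) :
    0 ≤ 2 * (∫ p, f p * g p * h p ∂volume) + (∫ p, f p ∂volume) * (∫ p, g p ∂volume) * (∫ p, h p ∂volume) -
      ((∫ p, f p ∂volume) * (∫ p, g p * h p ∂volume) + (∫ p, g p ∂volume) * (∫ p, f p * h p ∂volume) +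
        (∫ p, h p ∂volume) * (∫ p, f p * g p ∂volume)) := by
  rw [← msahiE_three]
  refine liebSahi_thm37 3 ![f, g, h] (fun i x => ?_) fun i => ?_
  · fin_cases i
    · exact hf x
    · exact hg x
    · exact hh x
  · fin_cases i
    · exact hfa
    · exact hga
    · exact hha

/-- Theorem 2.1 in the increasing form. [cite: LiebSahi2021, Thm. 2.1 (with footnote 2)] -/
theorem liebSahi_thm21_monotone (f g h : I × I → ℝ) (hf : ∀ x, 0 ≤ f x) (hg : ∀ x, 0 ≤ g x)
    (hh : ∀ x, 0 ≤ h x) (hfm : Monotone f) (hgm : Monotone g) (hhm : Monotone h) :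
    0 ≤ msahiE (volume : Measure (I × I)) 3 ![f, g, h] := by
  refine msahiE_volume_nonneg_of_monotone 3 ![f, g, h] (fun i x => ?_) fun i => ?_
  · fin_cases i
    · exact hf x
    · exact hg x
    · exact hh x
  · fin_cases i
    · exact hfm
    · exact hgm
    · exact hhm

/-! ### The same for Lebesgue measure restricted to `[0,1]² ⊆ ℝ²` -/

/-- The inclusion `[0,1]² ↪ ℝ²` (plumbing). [folklore] -/
private def LebesgueSquare.incl : I × I → ℝ × ℝ := Prod.map Subtype.val Subtype.val

/-- The inclusion pushes Lebesgue measure of the square to Lebesgue measure of `ℝ²` restricted to `[0,1]²`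
(plumbing). [folklore] -/
private theorem measurePreserving_incl :
    MeasurePreserving LebesgueSquare.incl (volume : Measure (I × I))
      ((volume : Measure (ℝ × ℝ)).restrict (Set.Icc (0 : ℝ) 1 ×ˢ Set.Icc (0 : ℝ) 1)) := by
  rw [Measure.volume_eq_prod, Measure.volume_eq_prod, ← Measure.prod_restrict]
  exact unitInterval.measurePreserving_coe.prod unitInterval.measurePreserving_coe

/-- The inclusion is a measurable embedding (plumbing). [folklore] -/
private theorem measurableEmbedding_incl : MeasurableEmbedding LebesgueSquare.incl :=
  unitInterval.measurableEmbedding_coe.prodMap unitInterval.measurableEmbedding_coe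

/-- **Theorem 3.7 for functions on `ℝ²`** (Lebesgue measure restricted to `Q_2 = [0,1]²`, increasing form): if
`f_0,…,f_{n−1} : ℝ² → ℝ` are nonnegative and monotone increasing ON `[0,1]²`, then `E_n ≥ 0` for
`λ|_{[0,1]²}`. [cite: LiebSahi2021, Thm. 3.7 (with footnote 2)] -/
theorem msahiE_volume_restrict_unitSquare_nonneg_of_monotoneOn (n : ℕ) (f : Fin n → ℝ × ℝ → ℝ)
    (hf0 : ∀ i, ∀ x ∈ Set.Icc (0 : ℝ) 1 ×ˢ Set.Icc (0 : ℝ) 1, 0 ≤ f i x)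
    (hmono : ∀ i, MonotoneOn (f i) (Set.Icc (0 : ℝ) 1 ×ˢ Set.Icc (0 : ℝ) 1)) :
    0 ≤ msahiE ((volume : Measure (ℝ × ℝ)).restrict (Set.Icc (0 : ℝ) 1 ×ˢ Set.Icc (0 : ℝ) 1)) n f := by
  have hmem : ∀ p : I × I, LebesgueSquare.incl p ∈ Set.Icc (0 : ℝ) 1 ×ˢ Set.Icc (0 : ℝ) 1 :=
    fun p => ⟨p.1.2, p.2.2⟩
  rw [← msahiE_comp_measurePreserving measurePreserving_incl measurableEmbedding_incl n f]
  refine msahiE_volume_nonneg_of_monotone n _ (fun i p => hf0 i _ (hmem p)) fun i p q hpq => ?_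
  exact hmono i (hmem p) (hmem q) ⟨Subtype.coe_le_coe.2 hpq.1, Subtype.coe_le_coe.2 hpq.2⟩

/-- **Theorem 3.7 for functions on `ℝ²`, as printed** (decreasing form): nonnegative `f_i : ℝ² → ℝ` monotone
decreasing on `[0,1]²` have `E_n ≥ 0` for Lebesgue measure restricted to `[0,1]²`. [cite: LiebSahi2021, Thm. 3.7] -/
theorem liebSahi_thm37_real (n : ℕ) (f : Fin n → ℝ × ℝ → ℝ)
    (hf0 : ∀ i, ∀ x ∈ Set.Icc (0 : ℝ) 1 ×ˢ Set.Icc (0 : ℝ) 1, 0 ≤ f i x)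
    (hanti : ∀ i, AntitoneOn (f i) (Set.Icc (0 : ℝ) 1 ×ˢ Set.Icc (0 : ℝ) 1)) :
    0 ≤ msahiE ((volume : Measure (ℝ × ℝ)).restrict (Set.Icc (0 : ℝ) 1 ×ˢ Set.Icc (0 : ℝ) 1)) n f := by
  have hmem : ∀ p : I × I, LebesgueSquare.incl p ∈ Set.Icc (0 : ℝ) 1 ×ˢ Set.Icc (0 : ℝ) 1 :=
    fun p => ⟨p.1.2, p.2.2⟩
  rw [← msahiE_comp_measurePreserving measurePreserving_incl measurableEmbedding_incl n f]
  refine liebSahi_thm37 n _ (fun i p => hf0 i _ (hmem p)) fun i p q hpq => ?_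
  exact hanti i (hmem p) (hmem q) ⟨Subtype.coe_le_coe.2 hpq.1, Subtype.coe_le_coe.2 hpq.2⟩

/-! ### The unit interval (appended 2026-08-20, typer gen 5) -/

/-- **Sahi's inequalities for Lebesgue measure on `[0,1]`, every `n` (increasing form)**: for nonnegative
monotone increasing `f_i : [0,1] → ℝ`, `E_n(f_0,…,f_{n−1}) ≥ 0` — Lieb–Sahi: "Conjecture 1.1 holds for the
Lebesgue measure on `[0,1]`" (their remark after Lemma 3.2, there for initial-segment indicators; the general
case is the square theorem applied to functions of the first coordinate, `∫ g(x) dx dy = ∫ g`).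
[cite: LiebSahi2021, Lemma 3.2 (remark following it) and Thm. 3.7] -/
theorem msahiE_volume_unitInterval_nonneg_of_monotone (n : ℕ) (f : Fin n → I → ℝ) (hf0 : ∀ i x, 0 ≤ f i x)
    (hmono : ∀ i, Monotone (f i)) : 0 ≤ msahiE (volume : Measure I) n f := by
  have h := msahiE_volume_nonneg_of_monotone n (fun i (p : I × I) => f i p.1) (fun i p => hf0 i p.1)
    fun i p q hpq => hmono i hpq.1
  have hmom : ∀ S : Finset (Fin n), ∫ p, (∏ i ∈ S, fun p : I × I => f i p.1) p ∂volume =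
      ∫ x, (∏ i ∈ S, f i) x ∂volume := by
    intro S
    have hS : (∏ i ∈ S, fun p : I × I => f i p.1) = fun p => (∏ i ∈ S, f i) p.1 := by
      funext p
      simp only [Finset.prod_apply]
    rw [hS, Measure.volume_eq_prod, integral_fun_fst, probReal_univ, one_smul]
  rwa [msahiE_congr_of_moments volume volume (fun i (p : I × I) => f i p.1) f hmom] at h

/-- **Lebesgue measure on `[0,1]` is Sahi-positive of every order.** [cite: LiebSahi2021, Lemma 3.2 (remark following it)] -/
theorem mSahiPositive_volume_unitInterval (n : ℕ) : MSahiPositive (volume : Measure I) n :=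
  fun f hf0 hmono => msahiE_volume_unitInterval_nonneg_of_monotone n f hf0 hmono

/-- The decreasing (printed) form on `[0,1]`: nonnegative monotone decreasing `f_i` have `E_n ≥ 0` for Lebesgue
measure (reflection `x ↦ 1 − x`). [cite: LiebSahi2021, Lemma 3.2 (remark following it) and §2 (change of variables)] -/
theorem msahiE_volume_unitInterval_nonneg_of_antitone (n : ℕ) (f : Fin n → I → ℝ) (hf0 : ∀ i x, 0 ≤ f i x)
    (hanti : ∀ i, Antitone (f i)) : 0 ≤ msahiE (volume : Measure I) n f := by
  rw [← msahiE_comp_measurePreserving unitInterval.measurePreserving_symm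
    unitInterval.symmMeasurableEquiv.measurableEmbedding n f]
  exact msahiE_volume_unitInterval_nonneg_of_monotone n _ (fun i x => hf0 i _)
    fun i x y hxy => hanti i (unitInterval.symm_le_symm.2 hxy)

/-! ### Public grid API (appended 2026-08-20, typer gen 5): corners, cells under an arbitrary finite measure -/

namespace LebesgueSquare

variable {m : ℕ}

/-- `c⁻(p) ≤ p`: the lower-left corner of the cell of `p` is below `p`. [cite: LiebSahi2021, §2 (the squares `D_{i,j}`)] -/
theorem loCorner_le (p : I × I) : loCorner m (cellPair m p) ≤ p := loCorner_cellPair_le p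

/-- `p ≤ c⁺(p)`: `p` is below the upper-right corner of its cell. [cite: LiebSahi2021, §2 (the squares `D_{i,j}`)] -/
theorem le_hiCorner (p : I × I) : p ≤ hiCorner m (cellPair m p) := le_hiCorner_cellPair p

/-- The corner maps are monotone in the cell. [cite: LiebSahi2021, §2 (the squares `D_{i,j}`)] -/
theorem monotone_loCorner (m : ℕ) : Monotone (loCorner m) := loCorner_mono m

/-- The cell map is measurable. [cite: LiebSahi2021, §2 (the squares `D_{i,j}`)] -/
theorem cellPair_measurable (m : ℕ) : Measurable (cellPair m) := measurable_cellPair m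

/-- Every cell has Lebesgue area `1/(m+1)²`, the uniform grid weight. [cite: LiebSahi2021, §2 and Lemma 2.3 (proof)] -/
theorem volume_real_cell (c : Fin (m + 1) × Fin (m + 1)) :
    volume.real (cellPair m ⁻¹' {c}) = LiebSahiGrid.gridWeight (m + 1) c := volume_real_cellPair_preimage c

/-- The cell index is monotone (plumbing). [folklore] -/
private theorem cellIdx_mono (m : ℕ) : Monotone (cellIdx m) := by
  intro x y hxy
  change (cellIdx m x : ℕ) ≤ (cellIdx m y : ℕ)
  simp only [cellIdx]
  exact min_le_min_right m (Nat.floor_le_floor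
    (mul_le_mul_of_nonneg_left (Subtype.coe_le_coe.2 hxy) (by positivity)))

/-- The cell map is monotone. [cite: LiebSahi2021, §2 (the squares `D_{i,j}`)] -/
theorem cellPair_mono (m : ℕ) : Monotone (cellPair m) := fun _ _ h =>
  ⟨cellIdx_mono m h.1, cellIdx_mono m h.2⟩

/-- The cell map preserves `⊔` (it is monotone in each coordinate of a product of chains).
[cite: LiebSahi2021, §2 (the squares `D_{i,j}`)] -/
theorem cellPair_sup (p q : I × I) : cellPair m (p ⊔ q) = cellPair m p ⊔ cellPair m q :=
  Prod.ext ((cellIdx_mono m).map_max) ((cellIdx_mono m).map_max)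

/-- The cell map preserves `⊓`. [cite: LiebSahi2021, §2 (the squares `D_{i,j}`)] -/
theorem cellPair_inf (p q : I × I) : cellPair m (p ⊓ q) = cellPair m p ⊓ cellPair m q :=
  Prod.ext ((cellIdx_mono m).map_min) ((cellIdx_mono m).map_min)

/-- **Integral of a grid step function under an arbitrary finite measure** on the square:
`∫ γ(cell(p)) dμ(p) = Σ_c μ(cell c)·γ(c)`. [cite: LiebSahi2021, Lemma 2.3 (proof)] -/
theorem integral_comp_cellPair_measure (μ : Measure (I × I)) [IsFiniteMeasure μ]
    (γ : Fin (m + 1) × Fin (m + 1) → ℝ) :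
    ∫ p, γ (cellPair m p) ∂μ = ∑ c, μ.real (cellPair m ⁻¹' {c}) * γ c := by
  have hγ : AEStronglyMeasurable γ (μ.map (cellPair m)) := (measurable_of_countable γ).aestronglyMeasurable
  rw [← integral_map (measurable_cellPair m).aemeasurable hγ,
    integral_fintype (Integrable.of_finite (μ := μ.map (cellPair m)) (f := γ))]
  refine sum_congr rfl fun c _ => ?_
  rw [map_measureReal_apply (measurable_cellPair m) (measurableSet_singleton c), smul_eq_mul]

/-- A grid step function is integrable under any finite measure. [cite: LiebSahi2021, Lemma 2.3 (proof)] -/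
theorem integrable_comp_cellPair_measure (μ : Measure (I × I)) [IsFiniteMeasure μ]
    (γ : Fin (m + 1) × Fin (m + 1) → ℝ) : Integrable (fun p => γ (cellPair m p)) μ :=
  (Integrable.of_finite (μ := μ.map (cellPair m)) (f := γ)).comp_measurable (measurable_cellPair m)

/-- The two-way telescoping bound in weighted form: for a monotone `g` and cell weights `0 ≤ w(c) ≤ W`,
`Σ_c w(c)(g(c⁺) − g(c⁻)) ≤ W · 2(m+1)(g(1,1) − g(0,0))`. [cite: LiebSahi2021, Lemma 2.3 (proof)] -/
theorem sum_weight_mul_sub_le {g : I × I → ℝ} (hg : Monotone g) (w : Fin (m + 1) × Fin (m + 1) → ℝ)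
    {W : ℝ} (hw0 : ∀ c, 0 ≤ w c) (hwW : ∀ c, w c ≤ W) :
    ∑ c, w c * (g (hiCorner m c) - g (loCorner m c)) ≤ W * (2 * ((m : ℝ) + 1) * (g (1, 1) - g (0, 0))) := by
  have hnn : ∀ c : Fin (m + 1) × Fin (m + 1), 0 ≤ g (hiCorner m c) - g (loCorner m c) := fun c =>
    sub_nonneg.2 (hg ⟨gridPt_mono _ (Nat.le_succ _), gridPt_mono _ (Nat.le_succ _)⟩)
  calc ∑ c, w c * (g (hiCorner m c) - g (loCorner m c))
      ≤ ∑ c, W * (g (hiCorner m c) - g (loCorner m c)) :=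
        sum_le_sum fun c _ => mul_le_mul_of_nonneg_right (hwW c) (hnn c)
    _ = W * ∑ c : Fin (m + 1) × Fin (m + 1), (g (hiCorner m c) - g (loCorner m c)) := by rw [mul_sum]
    _ ≤ W * (2 * ((m : ℝ) + 1) * (g (1, 1) - g (0, 0))) := by
        refine mul_le_mul_of_nonneg_left ?_ ((hw0 _).trans (hwW ((0 : Fin (m + 1)), (0 : Fin (m + 1)))))
        set h : ℕ → ℕ → ℝ := fun a b => g (gridPt (m + 1) a, gridPt (m + 1) b) with hh
        have h1 : ∀ b, Monotone fun a => h a b := fun b a a' haa' => hg ⟨gridPt_mono _ haa', le_rfl⟩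
        have h2 : ∀ a, Monotone fun b => h a b := fun a b b' hbb' => hg ⟨le_rfl, gridPt_mono _ hbb'⟩
        have hsum : ∑ c : Fin (m + 1) × Fin (m + 1), (g (hiCorner m c) - g (loCorner m c)) =
            ∑ a ∈ range (m + 1), ∑ b ∈ range (m + 1), (h (a + 1) (b + 1) - h a b) := by
          rw [Fintype.sum_prod_type]
          simp only [Finset.sum_range]
          rfl
        have hmm : h (m + 1) (m + 1) - h 0 0 ≤ g (1, 1) - g (0, 0) :=
          sub_le_sub (hg (le_one_one _)) (hg ⟨zero_le_gridPt _ _, zero_le_gridPt _ _⟩)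
        rw [hsum]
        refine (sum_sub_le_of_monotone h h1 h2 m).trans ?_
        have : (0 : ℝ) ≤ 2 * ((m : ℝ) + 1) := by positivity
        nlinarith [hmm]

end LebesgueSquare

end Literature.Combinatorics.Sahi2008
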